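import Summits.BirchSwinnertonDyer.BirchSwinnertonDyer.Theorems.RamifiedSevenEllipticUnitsFrameDataOfGZK
import HarnessLib

set_option linter.dupNamespace false
set_option autoImplicit false

/-!
# Route `RamifiedSevenEllipticUnits` (rung K7r): the support item `FrameDataSevenOfGZK`
# (stmt-BirchSwinnertonDyer-19122, planner ruling D75) — CLOSED by name

Cell `bsd-cm`, seat `bsd-cm-ram` (g5). D75 (planner g12) replaced the un-closable closed item
`FrameDataSeven` (stmt-19146, now `aside`) by its GZK-conditional twin `FrameDataSevenOfGZK :=
rank_eq_analyticRank_of_analyticRank_le_one → (frame data at 7 for every W ∈ 𝒞₇)`, which is exactly the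
type of `frameDataSeven_of_GZK` (p410208, `Theorems/RamifiedSevenEllipticUnitsFrameDataOfGZK.lean`:
the CM field `ℚ(√−7)` with a prime above `7`, the globally minimal frame twin and its isogeny, the
anticyclotomic `ℤ_7`-extension with a topological generator, Mordell–Weil generators with their
`7`-divisibility levels and `E(ℚ_7)[7] = 0`, all constructed in the tree; GZK supplies `rank_ℤ = 1`).
Nothing new is asserted.
-/

namespace Summit.BirchSwinnertonDyer.BirchSwinnertonDyer.Theorems

/-- **`FrameDataSevenOfGZK` (stmt-BirchSwinnertonDyer-19122) holds**: it is `frameDataSeven_of_GZK`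
(p410208) read at the route item's fully-qualified type. [cite: Darmon2004, Thm. 3.22 (= Thm. 1.14) and §3.9]
[cite: SilvermanAEC2009, Prop. VII.6.3 and Thm. VIII.6.7] -/
theorem frameDataSevenOfGZK_proof :
    Summit.BirchSwinnertonDyer.BirchSwinnertonDyer.Theses.RamifiedSevenEllipticUnits.FrameDataSevenOfGZK :=
  fun h => RamifiedSevenEllipticUnits.frameDataSeven_of_GZK h

end Summit.BirchSwinnertonDyer.BirchSwinnertonDyer.Theorems
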